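import Literature.IUT.HodgeArakelov.ThetaEnvDataRecordProp31AtModelTate
import Literature.IUT.HodgeArakelov.BadPrimeGaussianMonoidsGenuineRecordSplittingOfThetaKummerOrbit
import Literature.IUT.HodgeArakelov.BadPrimeGaussianMonoidsGenuineRecordOfInvClauses
import HarnessLib

/-!
# [IUTchII] Prop 3.1 (i)(ii): the PACKAGED `Prop31Statements` AT THE GENERIC GENUINE `θ_env` RECORD over `ℚ̄_pˣ`, print-faithful
# OUTER inversion family through a pointed inversion PAIR — the three GENERIC one-label J3 closers composed with the label
# transport (proof-only consumer knit; routes (α) function carrier / (β) inversion clauses / bare pair)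

S. Mochizuki, *Inter-universal Teichmüller theory II*, kurims manuscript (Dec. 2020), §3 Prop. 3.1 (i) p. 87 l. 47–53
(«one obtains a functorial algorithm `M^Θ_* ↦ {M^×_TM(M^Θ_*), θ^ι_env(M^Θ_*), ∞θ^ι_env(M^Θ_*), …}_ι` … where `ι` ranges
over the inversion automorphisms of Proposition 2.2, (i) … equipped with a natural conjugation action by `Π_X(M^Θ_*)` …
splittings up to torsion»), (ii) p. 88; Rmk. 1.4.1 (ii) p. 28 (`ι_Ÿ` is an OUTER automorphism, unique up to `l·ℤ`-conjugacy
and `Gal(Ÿ̲̲/Y̲̲)`) [cite: Mochizuki2012, Prop 3.1 (i) p.87]; S. Mochizuki, *The étale theta function …* [EtTh], Publ. RIMS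
**45** (2009): Prop. 1.4 (ii) p. 22, Prop. 1.5 (ii)(iii) p. 23 [cite: MochizukiEtTh2009, Prop 1.5 (iii) p.23]. Claim key
`Mochizuki2012` (D-0012, DISPUTED): every theorem below is a COMPOSITION of LANDED theorems over the cell's OWN objects;
nothing of the series is asserted; no side is taken on [IUTchIII] Cor. 3.12; typed ≠ proved ≠ endorsed. PROOF-ONLY companion
(abc-iut cell, layer L6, seat abc-iut-L6-d3 gen 8, row «PROP31-PACKAGED-KNIT@thetaKummerOrbit», abc-iut-L6-lead gen 8
§F v1.19dt (A2); the sibling rows T1/T2 sized by abc-iut-L6-t1 gen 8 (2026-08-27T03:57:33Z) and yielded to this seat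
(04:00:40Z); residual-delta sizing of abc-iut-w5-d043 gen 10 (03:55:49Z)); cone node **IUTchII:Prop3.1(i)** (dag id
`N_IUTchII_Prop3_1_i`); L-F register row LF6-02 = frozen FACT-LIST row F-2567 `TemperedThetaMonoids.Prop31Statements`
(«universal-closure REFUTED / schema; instance forms are the content»). NO definition, NO `Prop` fact, NO instance; nothing
landed is edited or restated.

WHY / WHAT IS NEW. abc-iut-w5-d031's `ThetaEnvDataRecordProp31.lean` (p492714) packages the WHOLE `Prop31Statements` at the
genuine record, for BOTH inversion families, from a splitting up to torsion of `(M^×_TM, ⟨∞θ^j_env⟩)` at ONE label `j`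
(`prop31Statements_thetaEnvRecordOuterKummer_of_splitting_at`); its §4 knit is over p433555 (INNER family, `horb`/`htors`
binders) and `ThetaEnvDataRecordProp31AtModelTate.lean` (p493591) is the K-L6 MODEL instance. None of the THREE GENERIC
one-label J3 closers for a pointed inversion PAIR — all stated for an ARBITRARY inversion family `iota` whose `i₀`-th action
is the transport `pairRhoLim` of the pair — had a `Prop31Statements`-headed consumer:
* (T1) abc-iut-w4-d004's `splitting_toRecord_padic_of_eval_pairRhoLim` (p441594): ANY pair `(αι, βι)` reversing the
  `ℤ`-torsor, (R2)(R3) `hsign`/`hroot`/`hfree` and `hker` as binders, `horb`/`htors` DISCHARGED;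
* (T2) abc-iut-w5-d169's `splitting_toRecord_padic_of_eval_inversion_of_invClauses` (route (β)): the pair
  `(inversionAlpha C ι hι, ι^Θ)` of an INVERSION AUTOMORPHISM (`IsInversionAut` + `InvClauses`, pointed) — NO class-level
  binder, NO function carrier, NO `hker`;
* (T3) abc-iut-w4-d035's `splitting_toRecord_padic_of_eval_inversion_of_thetaKummerOrbit` (p488082, the NODES v3.4cb
  closer, route (α)): the same pair for any lift `ι` with the MINIMAL function-level [EtTh] Prop. 1.4 (ii) package — NO
  class-level binder, NO `hker`.
THIS FILE composes each with the label transport at abc-iut-w4-d019's PRINT-FAITHFUL OUTER family `thetaEnvRecordOuterKummer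
… e₀ c hA hfi O` (inversions = the `Π^tp_{X̲̲}`-conjugates `conj_g ∘ e₀ ∘ conj_g⁻¹` of ONE action `e₀`), `e₀ :=` the pair's
`pairRhoLim` (`he₀`), whose label-`1` member IS `e₀` (abc-iut-w5-d031's `h1LimConjEquiv_one_conj_outer`, p493591):
* §1 (any record `E`): `θ^ι_env`- / `∞θ^ι_env`-splittings at EVERY label from ONE label along the conjugation action
  (`isSplittingUpToTorsion_thetaEnv_of_reach` / `…_inftyThetaEnv_of_reach`; p492714's transport lemmas iterated);
* §2 (genuine record, both families): every label is reached from every label for the `θ^ι_env`-family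
  (`exists_image_conj_thetaEnv_thetaEnvRecord(Outer)`; p492714 records the `∞θ`-halves);
* §3 (outer family, any `e₀`): from BOTH one-label clauses at the label `1`, the WHOLE `Prop31Statements` AND the
  `θ^ι_env`-companion at EVERY label (`prop31Statements_and_thetaEnv_thetaEnvRecordOuterKummer_of_splittings_one`);
* §4 (over `ℚ̄_pˣ`, ARBITRARY theta setting): **`prop31Statements_and_thetaEnv_thetaEnvRecordOuterKummer_padic_of_eval_pairRhoLim`**
  (T1), **`…_padic_of_inversion_of_invClauses`** (T2), **`…_padic_of_inversion_of_thetaKummerOrbit`** (T3): each = the WHOLE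
  `Prop31Statements` (conjugation action permuting `{Ψ^ι_env}_ι`; `(M^×_TM, ⟨∞θ^ι_env⟩)` a splitting up to torsion at EVERY
  `ι`; `Ψ_cns` conjugation-stable) ∧ `(M^×_TM, ⟨θ^ι_env⟩)` a splitting up to torsion at EVERY `ι`, at that record.
RESIDUAL BY NAME (each theorem: exactly its closer's binders with `{Iota, iota, i₀, hi₀}` replaced by `{e₀, he₀}`, plus
`Π^tp_{X̲̲}`-stability of `O` (`hOst`)): (T1) the pair `(αι, βι, hφαβ, hAβ, hH)`, `γ ε hγ hε₁ hε₂ hαγ`, (R2)(R3)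
`hsign`/`hroot`/`hfree`, `hker`; (T2) the inversion automorphism {`ι`, `IsInversionAut ι`, `hι`, companion `cι`, `InvClauses`
(abc-iut-L2-t1's post-freeze typing of the PRINTED [EtTh] Prop. 1.5 (iii) clause — a hypothesis BY NAME, not a FACT-LIST row),
(h_sq) `δ ∈ Π^tp_{Ÿ̲̲}`, `ι² = Ad(δ)`}, the class-level deck-sign clause `hdeck`, `IsEtThOrigin` (F-2498) / `Prop15ii` (F-2503),
a `CyclotomeTower`; (T3) the inversion datum (`ι`, `hι`, `cι`, `γ hγ hZι`, `δ hιι`, `hβ`), `IsEtThOrigin` / `Prop15ii`, a tower,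
and the MINIMAL function-level package {`T : ThetaKummerInput`, `hη`, `hdeck`, `ιFn`, `hιFn`, `hΛ`, `hιθ`}; (all) the record
inputs (incl. (H1) `PiYddCharacteristic C` = F-2633 AT THE INSTANCE and `Prop15iii` F-0591 = `h15`) and the Cor. 3.5 (K)/(E)
DATA (constants `c`/`c₀` on `ℚ̄_pˣ` bijective with `μ ⊆ O` and `c₀ = c` on elements, ONE evaluation section `s₀` with `hact`
and finite-index image, a base point `θ ∈ θ^{1}_env` with `R₀ θ = κ₀ q`, `q` a non-unit). NO FACT-LIST row consumed beyond
those named; NO `horb`/`htors` binder.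

HONEST CAVEATS (carried from the closers): `ThetaKummerInput` (T3) is a DATA carrier quoting print; abc-iut-w5-d125's census
(GAP-LEDGER D-G-w4d010-2f): the route-(α) inputs {`hιFn`, `hΛ`, `hιθ`} with genuine constants are UNSATISFIABLE at the
semi-synthetic model `modelχ` for every vertex-0 inner lift — joint satisfiability of a theorem's binders at a model is NOT
claimed here (the model instance of record is p493591 over abc-iut-w5-d072's p461404). An instance-form theorem at OUR record
is not the print universal closure (refuted as a schema, `TemperedThetaMonoidsProp31SchemaCertificate.lean`); no side is
taken on [IUTchIII] Cor. 3.12 nor on which lift of the inversion print's `ι` denotes; nothing here asserts that abc is proved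
or refuted. [claim: Mochizuki2012, status: disputed]
-/

noncomputable section

namespace Literature.IUT.HodgeArakelov

/-! ### §1. Generic record level: splittings at EVERY label from ONE label along the conjugation action -/

namespace TemperedThetaMonoids

namespace ThetaEnvData

universe u v

variable {P : Type u} [Group P] (E : ThetaEnvData.{u, v} P)

/-- **`θ^ι_env`-splittings at EVERY label from ONE label** ([IUTchII] Prop. 3.1 (i) p. 87: the conjugation action by
`Π_X(M^Θ_*)` permutes the labels): if `Ψ_cns` is conjugation-stable (whence `M^×_TM` is, abc-iut-L6-t2's
`units_conjStable_of_constants`), every label `ι` is reached from `i₀` (`conj g ″ θ^{i₀}_env = θ^ι_env` for some `g`) and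
`(M^×_TM, ⟨θ^{i₀}_env⟩)` is a splitting up to torsion, then so is `(M^×_TM, ⟨θ^ι_env⟩)` for every `ι` — abc-iut-w5-d031's
transport lemma `isSplittingUpToTorsion_thetaEnv_of_image_eq` (p492714) iterated over the orbit.
[claim: Mochizuki2012, status: disputed] (IUTchII §3 Prop 3.1 (i), kurims p.87) -/
theorem isSplittingUpToTorsion_thetaEnv_of_reach (hcns : E.IsConjStable E.constantMonoid) (i₀ : E.Iota)
    (hreach : ∀ ι : E.Iota, ∃ g : P, E.conj g '' E.thetaEnv i₀ = E.thetaEnv ι)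
    (hsplit : IsSplittingUpToTorsion E.units (Submonoid.closure (E.thetaEnv i₀))) (ι : E.Iota) :
    IsSplittingUpToTorsion E.units (Submonoid.closure (E.thetaEnv ι)) := by
  obtain ⟨g, hg⟩ := hreach ι
  exact E.isSplittingUpToTorsion_thetaEnv_of_image_eq g (units_conjStable_of_constants E hcns) hg hsplit

/-- The `∞θ^ι_env`-form of the same iteration (the `splitting` field of `Prop31Statements` at every label from one label —
the field as assembled inside abc-iut-w5-d031's `prop31Statements_of_splitting_at`, recorded as a stand-alone lemma).
[claim: Mochizuki2012, status: disputed] (IUTchII §3 Prop 3.1 (i), kurims p.87) -/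
theorem isSplittingUpToTorsion_inftyThetaEnv_of_reach (hcns : E.IsConjStable E.constantMonoid) (i₀ : E.Iota)
    (hreach : ∀ ι : E.Iota, ∃ g : P, E.conj g '' E.inftyThetaEnv i₀ = E.inftyThetaEnv ι)
    (hsplit : IsSplittingUpToTorsion E.units (Submonoid.closure (E.inftyThetaEnv i₀))) (ι : E.Iota) :
    IsSplittingUpToTorsion E.units (Submonoid.closure (E.inftyThetaEnv ι)) := by
  obtain ⟨g, hg⟩ := hreach ι
  exact E.isSplittingUpToTorsion_inftyThetaEnv_of_image_eq g (units_conjStable_of_constants E hcns) hg hsplit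

end ThetaEnvData

end TemperedThetaMonoids

/-! ### §2. The GENUINE record: every label is reached from every label, `θ^ι_env`-family (both inversion families) -/

namespace EtaleLevels

open Literature.AnabelianGeometry.EtaleTheta CohomologySystemOfContH1 EtaleThetaDataOfSetting

variable {p : ℕ} [Fact p.Prime] {D : Literature.AnabelianGeometry.EtaleTheta.ThetaSetting p}
  {E : D.EtaleThetaData} {l : ℕ} (C : E.DoubleUnderline l) (hC : D.Compat) (hS : D.Sec2Hyps)
  (hl : l.Prime) (hp2 : p ≠ 2) (hpl : p ≠ l) (hζ : ∃ ζ : D.K, IsPrimitiveRoot ζ (4 * l))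
  (mods : ∀ M : ℕ+, D.CyclotomeMod l M)
  (f : contCocycles D.toTheta D.DeltaTheta C.GtpYdduu) (hf : f ∈ C.rootCocycles hC)
  (hmods : ∀ (M M' : ℕ+) (h : (M : ℕ) ∣ (M' : ℕ)) (x : D.lDeltaTheta l),
    MuN.red p M M' h ((mods M').red x) = (mods M).red x)
  (h15 : Literature.AnabelianGeometry.EtaleTheta.ThetaSetting.Prop15iii E hC) (L : C.CuspLabels)
  (hZ : ∀ M : ℕ+, Nonempty (ModelCyclotomes.lDeltaQuot (C.rigidData (mods M) hC hS h15 L) ≃*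
    Literature.IUT.HodgeTheaters.ZHat))
  (hcharY : EtaleThetaDataOfSetting.PiYddCharacteristic C)
  (hlim : Function.Bijective (rigidLimHom C hC hS hl hp2 hpl hζ mods f hf hmods h15 L hZ))
  [(EtaleThetaDataOfSetting.PiYdd C).Normal]

section Families

variable {M : Type} [CommMonoid M]
  (κ : M →* Multiplicative (h1Lim (phi C) (D.lDeltaTheta l) (PiYdd C) ⊥))
  (e₀ : h1Lim (phi C) (D.lDeltaTheta l) (PiYdd C) ⊥ ≃+ h1Lim (phi C) (D.lDeltaTheta l) (PiYdd C) ⊥)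

include hcharY in
/-- **Every label is reached from every label, inner family, `θ^ι_env`-half** ([IUTchII] Prop. 3.1 (i) p. 87): for
abc-iut-w4-d019's `thetaEnvRecord κ ι₀` and labels `j`, `ι ∈ Π^tp_{X̲̲}`, `conj (ι j⁻¹) ″ θ^j_env = θ^ι_env` — from
abc-iut-w5-d031's explicit-label J2 `image_conj_thetaEnv_thetaEnvRecord` (p492714).
[claim: Mochizuki2012, status: disputed] (IUTchII §3 Prop 3.1 (i), kurims p.87) -/
theorem exists_image_conj_thetaEnv_thetaEnvRecord (ι₀ j ι : Pi C) :
    ∃ g : Pi C, (thetaEnvRecord C hC hS hl hp2 hpl hζ mods f hf hmods h15 L hZ hcharY hlim κ ι₀).conj g ''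
        (thetaEnvRecord C hC hS hl hp2 hpl hζ mods f hf hmods h15 L hZ hcharY hlim κ ι₀).thetaEnv j =
      (thetaEnvRecord C hC hS hl hp2 hpl hζ mods f hf hmods h15 L hZ hcharY hlim κ ι₀).thetaEnv ι :=
  ⟨ι * j⁻¹, by
    rw [image_conj_thetaEnv_thetaEnvRecord C hC hS hl hp2 hpl hζ mods f hf hmods h15 L hZ hcharY hlim κ ι₀,
      inv_mul_cancel_right]⟩

include hcharY in
/-- **Every label is reached from every label, print-faithful OUTER family, `θ^ι_env`-half** ([IUTchII] Prop. 3.1 (i)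
p. 87; Rmk. 1.4.1 (ii) p. 28): for abc-iut-w4-d019's `thetaEnvRecordOuter κ e₀`, `conj (ι j⁻¹) ″ θ^j_env = θ^ι_env` —
from abc-iut-w5-d031's `image_conj_thetaEnv_thetaEnvRecordOuter` (p492714), NO hypothesis on `e₀`.
[claim: Mochizuki2012, status: disputed] (IUTchII §3 Prop 3.1 (i), kurims p.87) -/
theorem exists_image_conj_thetaEnv_thetaEnvRecordOuter (j ι : Pi C) :
    ∃ g : Pi C, (thetaEnvRecordOuter C hC hS hl hp2 hpl hζ mods f hf hmods h15 L hZ hcharY hlim κ e₀).conj g ''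
        (thetaEnvRecordOuter C hC hS hl hp2 hpl hζ mods f hf hmods h15 L hZ hcharY hlim κ e₀).thetaEnv j =
      (thetaEnvRecordOuter C hC hS hl hp2 hpl hζ mods f hf hmods h15 L hZ hcharY hlim κ e₀).thetaEnv ι :=
  ⟨ι * j⁻¹, by
    rw [image_conj_thetaEnv_thetaEnvRecordOuter C hC hS hl hp2 hpl hζ mods f hf hmods h15 L hZ hcharY hlim κ e₀,
      inv_mul_cancel_right]⟩

end Families

/-! ### §3. Outer family, ANY `e₀`: both one-label clauses at the label `1` ⇒ the packaged structure ∧ the `θ`-companion -/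

section OuterPackaged

open TemperedThetaMonoids

variable (e₀ : h1Lim (phi C) (D.lDeltaTheta l) (PiYdd C) ⊥ ≃+ h1Lim (phi C) (D.lDeltaTheta l) (PiYdd C) ⊥)
  {A : Type} [CommGroup A] [MulDistribMulAction (Pi C) A] [TopologicalSpace A] [RootableBy A ℕ]
  (c : CyclotomeCoefficients (phi C) (D.lDeltaTheta l) A)
  (hA : ∀ b : A, IsOpen (MulAction.stabilizer (Pi C) b : Set (Pi C)))
  (hfi : ∀ b : A, (MulAction.stabilizer (Pi C) b).FiniteIndex)
  (O : Submonoid A) (hOst : ∀ (σ : Pi C) (b : A), b ∈ O → σ • b ∈ O)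

include hcharY hOst in
/-- **Packaging at the OUTER family from the label `1`** ([IUTchII] Prop. 3.1 (i)(ii) p. 87–88): for abc-iut-w4-d019's
`thetaEnvRecordOuterKummer … e₀ c hA hfi O` (ANY pointed action `e₀`; `Ψ_cns := κ(O)` with `O` `Π^tp_{X̲̲}`-stable), if BOTH
`(M^×_TM, ⟨∞θ^1_env⟩)` and `(M^×_TM, ⟨θ^1_env⟩)` are splittings up to torsion, then the WHOLE `Prop31Statements` holds
(abc-iut-w5-d031's `prop31Statements_thetaEnvRecordOuterKummer_of_splitting_at`, p492714, `j := 1`) AND `(M^×_TM, ⟨θ^ι_env⟩)`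
is a splitting up to torsion at EVERY label `ι` (§1 + §2; `Ψ_cns` stable by `constantMonoid_stable_thetaEnvRecordOuter`).
[claim: Mochizuki2012, status: disputed] (IUTchII §3 Prop 3.1 (i), kurims p.87) -/
theorem prop31Statements_and_thetaEnv_thetaEnvRecordOuterKummer_of_splittings_one
    (h : IsSplittingUpToTorsion
        (thetaEnvRecordOuterKummer C hC hS hl hp2 hpl hζ mods f hf hmods h15 L hZ hcharY hlim e₀ c hA hfi O).units
        (Submonoid.closure ((thetaEnvRecordOuterKummer C hC hS hl hp2 hpl hζ mods f hf hmods h15 L hZ hcharY hlim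
          e₀ c hA hfi O).inftyThetaEnv (1 : Pi C))) ∧
      IsSplittingUpToTorsion
        (thetaEnvRecordOuterKummer C hC hS hl hp2 hpl hζ mods f hf hmods h15 L hZ hcharY hlim e₀ c hA hfi O).units
        (Submonoid.closure ((thetaEnvRecordOuterKummer C hC hS hl hp2 hpl hζ mods f hf hmods h15 L hZ hcharY hlim
          e₀ c hA hfi O).thetaEnv (1 : Pi C)))) :
    TemperedThetaMonoids.Prop31Statements
        (thetaEnvRecordOuterKummer C hC hS hl hp2 hpl hζ mods f hf hmods h15 L hZ hcharY hlim e₀ c hA hfi O) ∧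
      ∀ j : Pi C, IsSplittingUpToTorsion
        (thetaEnvRecordOuterKummer C hC hS hl hp2 hpl hζ mods f hf hmods h15 L hZ hcharY hlim e₀ c hA hfi O).units
        (Submonoid.closure ((thetaEnvRecordOuterKummer C hC hS hl hp2 hpl hζ mods f hf hmods h15 L hZ hcharY hlim
          e₀ c hA hfi O).thetaEnv j)) :=
  ⟨prop31Statements_thetaEnvRecordOuterKummer_of_splitting_at C hC hS hl hp2 hpl hζ mods f hf hmods h15 L hZ hcharY hlim
      e₀ c hA hfi O hOst (1 : Pi C) h.1,
    TemperedThetaMonoids.ThetaEnvData.isSplittingUpToTorsion_thetaEnv_of_reach _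
      (constantMonoid_stable_thetaEnvRecordOuter C hC hS hl hp2 hpl hζ mods f hf hmods h15 L hZ hcharY hlim e₀ c hA hfi O
        hOst)
      (1 : Pi C)
      (fun ι => exists_image_conj_thetaEnv_thetaEnvRecordOuter C hC hS hl hp2 hpl hζ mods f hf hmods h15 L hZ hcharY hlim
        _ e₀ 1 ι)
      h.2⟩

end OuterPackaged

/-! ### §4. Over `ℚ̄_pˣ` at an ARBITRARY theta setting: the three GENERIC pointed-pair J3 closers, packaged -/

section Padic

open TemperedThetaMonoids BadPrimeGaussianMonoids

variable
  -- the Cor 3.5 (K)/(E) DATA over `ℚ̄_pˣ`, common to T1/T2/T3 (as in p441594 / p488082 / route (β))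
  {P₀ : TopGroup.{0}} (φ₀ : P₀ →* D.GtpTheta) (s₀ : P₀ →* Pi C)
  (hs₀ : Continuous ((MonoidHom.id (Pi C)).comp s₀))
  (hN : (⊤ : Subgroup P₀).map ((MonoidHom.id (Pi C)).comp s₀) ≤ PiYdd C)
  (hφ : (phi C).comp ((MonoidHom.id (Pi C)).comp s₀) = φ₀)
  [TopologicalSpace (PadicAlgCl p)ˣ]
  (c : CyclotomeCoefficients (phi C) (D.lDeltaTheta l) (PadicAlgCl p)ˣ)
  (hA : ∀ b : (PadicAlgCl p)ˣ, IsOpen (MulAction.stabilizer (Pi C) b : Set (Pi C)))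
  (hfi : ∀ b : (PadicAlgCl p)ˣ, (MulAction.stabilizer (Pi C) b).FiniteIndex)
  (O : Submonoid (PadicAlgCl p)ˣ) (hOst : ∀ (σ : Pi C) (b : (PadicAlgCl p)ˣ), b ∈ O → σ • b ∈ O)
  [MulDistribMulAction P₀ (PadicAlgCl p)ˣ]
  (c₀ : CyclotomeCoefficients φ₀ (D.lDeltaTheta l) (PadicAlgCl p)ˣ)
  (hA₀ : ∀ b : (PadicAlgCl p)ˣ, IsOpen (MulAction.stabilizer P₀ b : Set P₀))
  (hfi₀ : ∀ b : (PadicAlgCl p)ˣ, (MulAction.stabilizer P₀ b).FiniteIndex)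
  (hc : Function.Bijective c.hom) (hOtors : ∀ a : (PadicAlgCl p)ˣ, IsOfFinOrder a → a ∈ O ∧ a⁻¹ ∈ O)
  (hc₀ : Function.Bijective c₀.hom) (hc₀c : ∀ ζ, c₀.hom ζ = c.hom ζ)
  (hact : ∀ (g : P₀) (a : (PadicAlgCl p)ˣ), g • a = s₀ g • a)
  [((EtaleThetaDataOfSetting.aug C).comp s₀).range.FiniteIndex]
  -- the ONE pointed inversion action on the limit and the (E) evaluation datum at the label `1` of its outer family
  (e₀ : h1Lim (phi C) (D.lDeltaTheta l) (PiYdd C) ⊥ ≃+ h1Lim (phi C) (D.lDeltaTheta l) (PiYdd C) ⊥)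
  {θ : (thetaEnvRecordOuterKummer C hC hS hl hp2 hpl hζ mods f hf hmods h15 L hZ hcharY hlim e₀ c hA hfi O).H}
  (hθ : θ ∈ (thetaEnvRecordOuterKummer C hC hS hl hp2 hpl hζ mods f hf hmods h15 L hZ hcharY hlim
    e₀ c hA hfi O).thetaEnv (1 : Pi C))
  (R₀ : (thetaEnvRecordOuterKummer C hC hS hl hp2 hpl hζ mods f hf hmods h15 L hZ hcharY hlim e₀ c hA hfi O).H →*
    Multiplicative (h1Lim φ₀ (D.lDeltaTheta l) (⊤ : Subgroup P₀) ⊥))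
  (hR₀ : ∀ y, Multiplicative.toAdd (R₀ y) =
    h1LimCongr (D.lDeltaTheta l) ⊤ hφ ⊥
      (h1LimComap (phi C) (D.lDeltaTheta l) ((MonoidHom.id (Pi C)).comp s₀) hs₀ hN
        (AddEquiv.additiveMultiplicative (h1Lim (phi C) (D.lDeltaTheta l) (PiYdd C) ⊥) (Additive.ofMul y))))
  (q : O) (hRθ : R₀ θ = h1LimKummerOn φ₀ (D.lDeltaTheta l) ⊤ c₀ hA₀ hfi₀ O q) (hq : ¬ IsUnit q)

include hcharY hOst hc hOtors hc₀ hc₀c hact hθ hR₀ hRθ hq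

/-- **(T1) [IUTchII] Prop. 3.1 (i)(ii) — the PACKAGED `Prop31Statements` ∧ the `θ^ι_env`-companion AT THE GENERIC GENUINE
`θ_env` RECORD over `ℚ̄_pˣ`, print-faithful OUTER family through ANY pointed-inversion PAIR `(αι, βι)`** (p. 87 l. 47–53,
p. 88; Rmk. 1.4.1 (ii) p. 28): for `thetaEnvRecordOuterKummer … e₀ c hA hfi O` with `e₀ := pairRhoLim C αι βι …` (`he₀`),
ALL THREE typed clauses hold — `conj_permutes`, `splitting` at EVERY label, `constants_stable` — and `(M^×_TM, ⟨θ^ι_env⟩)` is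
a splitting up to torsion at EVERY label. Assembly BY NAME: §3 ∘ abc-iut-w4-d004's `splitting_toRecord_padic_of_eval_pairRhoLim`
(p441594) at the family `g ↦ conj_g ∘ e₀ ∘ conj_g⁻¹`, label `1` (member `= e₀`: abc-iut-w5-d031's
`h1LimConjEquiv_one_conj_outer`). RESIDUAL BY NAME = p441594's: the pair `(αι, βι, hφαβ, hAβ, hH)`, `γ ε hγ hε₁ hε₂ hαγ`,
(R2)(R3) `hsign`/`hroot`/`hfree`, `hker`, `μ ⊆ O` (`hOtors`), the Cor. 3.5 (K)/(E) DATA, `hOst`; record inputs incl. (H1)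
`hcharY` = F-2633 at the instance. [claim: Mochizuki2012, status: disputed] (IUTchII §3 Prop 3.1 (i), kurims p.87) -/
theorem prop31Statements_and_thetaEnv_thetaEnvRecordOuterKummer_padic_of_eval_pairRhoLim
    (αι : (Pi C) ≃ₜ* (Pi C)) (βι : D.GtpTheta ≃ₜ* D.GtpTheta) (hφαβ : ∀ g, βι (phi C g) = phi C (αι g))
    (hAβ : ∀ a : D.GtpTheta, a ∈ D.lDeltaTheta l ↔ βι a ∈ D.lDeltaTheta l)
    (hH : ∀ x, x ∈ PiYdd C ↔ αι x ∈ PiYdd C) (he₀ : e₀ = pairRhoLim C αι βι hφαβ hAβ hH)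
    (γ ε : Pi C) (hγ : C.toLZ γ = Multiplicative.ofAdd 1) (hε₁ : (ε : D.PiTemp) ∈ D.GtpY)
    (hε₂ : (ε : D.PiTemp) ∉ D.GtpYdd) (hαγ : C.toLZ (αι γ) = Multiplicative.ofAdd (-1))
    (hsign : ∃ κ : ContH1 (phi C) (D.lDeltaTheta l) (PiYdd C ⊓ ⊤), κ ^ 2 = 1 ∧
      ContH1.conj (phi C) (D.lDeltaTheta l) ε (rootLiftClass C) = rootLiftClass C * κ)
    (hroot : ∃ τ₀ : Pi C, (τ₀ : D.PiTemp) ∈ D.GtpY ∧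
      h1TopAut (phi C) (D.lDeltaTheta l) (PiYdd C) αι βι hφαβ (fun a ha => (hAβ a).mp ha) hH (rootLiftClass C) =
        ContH1.conj (phi C) (D.lDeltaTheta l) τ₀ (rootLiftClass C))
    (hfree : ∀ m n : ℤ, IsOfFinAddOrder
      ((h1Top C).symm (Additive.ofMul (ContH1.conj (phi C) (D.lDeltaTheta l) (γ ^ m) (rootLiftClass C))) -
        (h1Top C).symm (Additive.ofMul (ContH1.conj (phi C) (D.lDeltaTheta l) (γ ^ n) (rootLiftClass C)))) →
      m = n)
    (hker : ∀ y : (coh C).H1 ⊤, (coh C).toLim ⊤ y = 0 → IsOfFinAddOrder y) :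
    TemperedThetaMonoids.Prop31Statements
        (thetaEnvRecordOuterKummer C hC hS hl hp2 hpl hζ mods f hf hmods h15 L hZ hcharY hlim e₀ c hA hfi O) ∧
      ∀ j : Pi C, IsSplittingUpToTorsion
        (thetaEnvRecordOuterKummer C hC hS hl hp2 hpl hζ mods f hf hmods h15 L hZ hcharY hlim e₀ c hA hfi O).units
        (Submonoid.closure ((thetaEnvRecordOuterKummer C hC hS hl hp2 hpl hζ mods f hf hmods h15 L hZ hcharY hlim
          e₀ c hA hfi O).thetaEnv j)) :=
  prop31Statements_and_thetaEnv_thetaEnvRecordOuterKummer_of_splittings_one C hC hS hl hp2 hpl hζ mods f hf hmods h15 L hZ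
    hcharY hlim e₀ c hA hfi O hOst
    (splitting_toRecord_padic_of_eval_pairRhoLim C hC hS hl hp2 hpl hζ mods f hf hmods h15 L hZ hcharY hlim
      (fun g : Pi C =>
        ((h1LimConjEquiv (phi C) (D.lDeltaTheta l) (PiYdd C) g).symm.trans e₀).trans
          (h1LimConjEquiv (phi C) (D.lDeltaTheta l) (PiYdd C) g))
      φ₀ s₀ hs₀ hN hφ c hA hfi O c₀ hA₀ hfi₀ hc hOtors αι βι hφαβ hAβ hH γ ε hγ hε₁ hε₂ hαγ hsign hroot hfree hker hc₀ hc₀c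
      hact ((h1LimConjEquiv_one_conj_outer (phi C) (D.lDeltaTheta l) (PiYdd C) e₀).trans he₀) hθ R₀ hR₀ q hRθ hq)

/-- **(T2) [IUTchII] Prop. 3.1 (i)(ii) — the PACKAGED `Prop31Statements` ∧ the `θ^ι_env`-companion AT THE GENERIC GENUINE
`θ_env` RECORD over `ℚ̄_pˣ`, print-faithful OUTER family through the pointed pair of an INVERSION AUTOMORPHISM, route (β) —
NO class-level binder, NO function carrier, NO `hker`** (p. 87–88; [EtTh] Prop. 1.5 (iii) p. 23): for
`thetaEnvRecordOuterKummer … e₀ c hA hfi O` with `e₀ := pairRhoLim C (inversionAlpha C ι hι) ι^Θ …` (`he₀`), ALL THREE typed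
clauses hold and `(M^×_TM, ⟨θ^ι_env⟩)` is a splitting up to torsion at EVERY label. Assembly BY NAME: §3 ∘ abc-iut-w5-d169's
`splitting_toRecord_padic_of_eval_inversion_of_invClauses` at the outer family, label `1`. RESIDUAL BY NAME = that closer's:
{`ι`, `IsInversionAut ι`, `hι`, companion `cι`, `InvClauses` (abc-iut-L2-t1's typing of the PRINTED [EtTh] Prop. 1.5 (iii)
inversion clause — a hypothesis BY NAME), (h_sq) `δ ∈ Π^tp_{Ÿ̲̲}` with `ι² = Ad(δ)`}, the class-level deck-sign clause `hdeck`,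
`IsEtThOrigin` (F-2498) / `Prop15ii` (F-2503) (`Prop15iii` F-0591 = `h15`), a `CyclotomeTower`, `μ ⊆ O`, the Cor. 3.5 (K)/(E)
DATA, `hOst`; record inputs incl. (H1) `hcharY` = F-2633 at the instance. [claim: Mochizuki2012, status: disputed] (IUTchII §3 Prop 3.1 (i), kurims p.87) -/
theorem prop31Statements_and_thetaEnv_thetaEnvRecordOuterKummer_padic_of_inversion_of_invClauses [hYN : D.GtpYdd.Normal]
    (hO : D.IsEtThOrigin) (h15ii : ThetaSetting.Prop15ii E.toKummerData hC) {Es : Set ℕ+} (τc : D.CyclotomeTower l Es)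
    (ι : D.PiTemp ≃ₜ* D.PiTemp) (hι : C.Huu.map ι.toMulEquiv.toMonoidHom = C.Huu) (cι : ThetaSetting.ThetaCompanion ι)
    (hιA : D.IsInversionAut ι) (hInv : ThetaSetting.InvClauses E hιA cι)
    (δ : Pi C) (hδYdd : (δ : D.PiTemp) ∈ D.GtpYdd) (hιι : ∀ x : D.PiTemp, ι (ι x) = (δ : D.PiTemp) * x * (δ : D.PiTemp)⁻¹)
    (hdeck : ∀ ε : Pi C, (ε : D.PiTemp) ∈ D.GtpY → (ε : D.PiTemp) ∉ D.GtpYdd →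
      ContH1.conj D.toTheta D.DeltaTheta (ε : D.PiTemp) E.etaDd =
        D.inflTheta D.GtpYdd (E.kumYdd (E.toKddHat (-1))) * E.etaDd)
    (he₀ : e₀ = pairRhoLim C (inversionAlpha C ι hι) cι.thetaIso (thetaCompanion_phi C ι hι cι)
      (mem_lDeltaTheta_iff_thetaCompanion ι cι l) (mem_PiYdd_iff_of_piYddCharacteristic C hcharY _)) :
    TemperedThetaMonoids.Prop31Statements
        (thetaEnvRecordOuterKummer C hC hS hl hp2 hpl hζ mods f hf hmods h15 L hZ hcharY hlim e₀ c hA hfi O) ∧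
      ∀ j : Pi C, IsSplittingUpToTorsion
        (thetaEnvRecordOuterKummer C hC hS hl hp2 hpl hζ mods f hf hmods h15 L hZ hcharY hlim e₀ c hA hfi O).units
        (Submonoid.closure ((thetaEnvRecordOuterKummer C hC hS hl hp2 hpl hζ mods f hf hmods h15 L hZ hcharY hlim
          e₀ c hA hfi O).thetaEnv j)) :=
  prop31Statements_and_thetaEnv_thetaEnvRecordOuterKummer_of_splittings_one C hC hS hl hp2 hpl hζ mods f hf hmods h15 L hZ
    hcharY hlim e₀ c hA hfi O hOst
    (splitting_toRecord_padic_of_eval_inversion_of_invClauses C hC hS hl hp2 hpl hζ mods f hf hmods h15 L hZ hcharY hlim hO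
      h15ii ι hι cι hιA hInv δ hδYdd hιι hdeck τc
      (fun g : Pi C =>
        ((h1LimConjEquiv (phi C) (D.lDeltaTheta l) (PiYdd C) g).symm.trans e₀).trans
          (h1LimConjEquiv (phi C) (D.lDeltaTheta l) (PiYdd C) g))
      φ₀ s₀ hs₀ hN hφ c hA hfi O c₀ hA₀ hfi₀ hc hOtors hc₀ hc₀c hact
      ((h1LimConjEquiv_one_conj_outer (phi C) (D.lDeltaTheta l) (PiYdd C) e₀).trans he₀) hθ R₀ hR₀ q hRθ hq)

/-- **(T3) [IUTchII] Prop. 3.1 (i)(ii) — the PACKAGED `Prop31Statements` ∧ the `θ^ι_env`-companion AT THE GENERIC GENUINE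
`θ_env` RECORD over `ℚ̄_pˣ`, print-faithful OUTER family through the pointed pair of any lift `ι`, route (α) — NO class-level
binder, NO `hker`** (p. 87–88; [EtTh] Prop. 1.4 (ii) p. 22): for `thetaEnvRecordOuterKummer … e₀ c hA hfi O` with
`e₀ := pairRhoLim C (inversionAlpha C ι hι) ι^Θ …` (`he₀`), ALL THREE typed clauses hold and `(M^×_TM, ⟨θ^ι_env⟩)` is a
splitting up to torsion at EVERY label. Assembly BY NAME: §3 ∘ abc-iut-w4-d035's
`splitting_toRecord_padic_of_eval_inversion_of_thetaKummerOrbit` (p488082, the NODES v3.4cb closer of IUTchII:Prop3.1(i)) at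
the outer family, label `1`. RESIDUAL BY NAME = p488082's: the inversion datum (`ι`, `hι`, companion `cι`, `ℤ`-reversal `hZι`
at a `toLZ`-generator `γ`, `ι² = conj δ`, `hβ`), `IsEtThOrigin` (F-2498) / `Prop15ii` (F-2503) (`Prop15iii` F-0591 = `h15`),
a `CyclotomeTower`, `μ ⊆ O`, the Cor. 3.5 (K)/(E) DATA, `hOst`, and the MINIMAL function-level [EtTh] Prop. 1.4 (ii) package
{`T : ThetaKummerInput`, `hη`, `hdeck`, `ιFn`, `hιFn`, `hΛ`, `hιθ`} (abc-iut-L2-t12); record inputs incl. (H1) `hcharY` =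
F-2633 at the instance. Joint satisfiability of the route-(α) package at a model is NOT claimed (module docstring; model
instance of record: p493591). [claim: Mochizuki2012, status: disputed] (IUTchII §3 Prop 3.1 (i), kurims p.87) -/
theorem prop31Statements_and_thetaEnv_thetaEnvRecordOuterKummer_padic_of_inversion_of_thetaKummerOrbit
    [hYN : D.GtpYdd.Normal] (hO : D.IsEtThOrigin) {Es : Set ℕ+} (τc : D.CyclotomeTower l Es)
    (ι : D.PiTemp ≃ₜ* D.PiTemp) (hι : C.Huu.map ι.toMulEquiv.toMonoidHom = C.Huu) (cι : ThetaSetting.ThetaCompanion ι)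
    (γ : Pi C) (hγ : C.toLZ γ = Multiplicative.ofAdd 1) (hZι : D.toZ (ι (γ : D.PiTemp)) = (D.toZ (γ : D.PiTemp))⁻¹)
    (δ : Pi C) (hιι : ∀ x : Pi C, ι (ι (x : D.PiTemp)) = (δ : D.PiTemp) * (x : D.PiTemp) * (δ : D.PiTemp)⁻¹)
    (hβ : ∀ a : D.GtpTheta, a ∈ D.DeltaTheta → cι.thetaIso a * a⁻¹ ∈ D.lDeltaTheta l)
    (he₀ : e₀ = pairRhoLim C (inversionAlpha C ι hι) cι.thetaIso (thetaCompanion_phi C ι hι cι)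
      (mem_lDeltaTheta_iff_thetaCompanion ι cι l) (mem_PiYdd_iff_of_piYddCharacteristic C hcharY _))
    -- [EtTh] Prop 1.5 (ii) for `E` (F-2503) and the MINIMAL FUNCTION-level [EtTh] Prop 1.4 (ii) package (abc-iut-L2-t12)
    (h15ii : ThetaSetting.Prop15ii E.toKummerData hC)
    (T : D.ThetaKummerInput) (hη : E.etaDd = T.kummerTheta)
    (hdeck : ∀ e' : D.PiTemp, e' ∈ D.GtpY → e' ∉ D.GtpYdd → e' • T.theta = T.const (-1) * T.theta)
    (ιFn : T.Fn →* T.Fn)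
    (hιFn : ∀ (g : Pi C) (fn : T.Fn), ιFn ((g : D.PiTemp) • fn) = ι (g : D.PiTemp) • ιFn fn)
    (hΛ : ∀ ζ : cyclotome T.Fn, ContH1Aut.coeffMap D.DeltaTheta cι.thetaIso (thetaCompanion_mem_deltaTheta ι cι)
        (T.coeff.hom ζ) = T.coeff.hom (cyclotome.map ιFn ζ))
    (hιθ : ιFn T.theta = T.const (-1) * T.theta) :
    TemperedThetaMonoids.Prop31Statements
        (thetaEnvRecordOuterKummer C hC hS hl hp2 hpl hζ mods f hf hmods h15 L hZ hcharY hlim e₀ c hA hfi O) ∧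
      ∀ j : Pi C, IsSplittingUpToTorsion
        (thetaEnvRecordOuterKummer C hC hS hl hp2 hpl hζ mods f hf hmods h15 L hZ hcharY hlim e₀ c hA hfi O).units
        (Submonoid.closure ((thetaEnvRecordOuterKummer C hC hS hl hp2 hpl hζ mods f hf hmods h15 L hZ hcharY hlim
          e₀ c hA hfi O).thetaEnv j)) :=
  prop31Statements_and_thetaEnv_thetaEnvRecordOuterKummer_of_splittings_one C hC hS hl hp2 hpl hζ mods f hf hmods h15 L hZ
    hcharY hlim e₀ c hA hfi O hOst
    (splitting_toRecord_padic_of_eval_inversion_of_thetaKummerOrbit C hC hS hl hp2 hpl hζ mods f hf hmods h15 L hZ hcharY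
      hlim hO τc ι hι cι γ hγ hZι δ hιι hβ
      (fun g : Pi C =>
        ((h1LimConjEquiv (phi C) (D.lDeltaTheta l) (PiYdd C) g).symm.trans e₀).trans
          (h1LimConjEquiv (phi C) (D.lDeltaTheta l) (PiYdd C) g))
      φ₀ s₀ hs₀ hN hφ c hA hfi O c₀ hA₀ hfi₀ hc hOtors hc₀ hc₀c hact
      ((h1LimConjEquiv_one_conj_outer (phi C) (D.lDeltaTheta l) (PiYdd C) e₀).trans he₀) hθ R₀ hR₀ q hRθ hq h15ii T hη
      hdeck ιFn hιFn hΛ hιθ)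

end Padic

end EtaleLevels

end Literature.IUT.HodgeArakelov

end
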